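import Summits.RiemannHypothesis.RiemannHypothesis.Theorems.WeilFormatCTailOddJ
import Summits.RiemannHypothesis.RiemannHypothesis.Theorems.WeilFormatCTailEvenJMS
import HarnessLib

/-!
# Format C, L-C3b (odd sector): the order-`J` tail majorant with the MEAN-SQUARE bound for the mode function

Route context: Fourier–Galerkin / Schur-complement certificates of Weil positivity on a window ("format C";
cell memo `run/shared/lean/pub/rh-explicit/rh-explicit-weil-10/FORMATC-DESIGN.md` §9.9.3 (ii); supporting
stmt-RiemannHypothesis-0098; seat rh-explicit-weil-10; lead ruling R7-43 (2)).  This is `WeilFormatC.odd_tailJ_majorant`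
with ONE change: in the `A`-family term the square of the mode function `F_{l+1}²` is not bounded by `C_A²` mode by mode
but summed against `P_A(l+1)²` with `WeilFormatC.sum_Ico_modeF_sq_mul_sq_le` (tail start `B₃+1` in mode units; mean
square `½Σ_kΛ_k²/k` of the prime sum plus Abel-bounded oscillatory terms; resonance data `s₁, s₋, s₊`, value `0` =
crude).  At `a = 1` (kit job j165180, block 320, `J = 4`) the minimal exact-column range shortens from `B₃ = 896` to `768`.

* `odd_tailJMS_majorant` — functional form (every truncation `N`);
* `odd_tailJMS_majorant_matrix` — the same as `xᵀU₂x` for the explicit matrix.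

Standard axioms; no definitions; no RH claim.
-/

set_option autoImplicit false
-- `Summit.RiemannHypothesis.RiemannHypothesis.…` is the layout-mandated namespace (summit = problem name).
set_option linter.dupNamespace false

noncomputable section

open Complex Finset Matrix
open scoped Real BigOperators ArithmeticFunction.vonMangoldt

namespace Summit.RiemannHypothesis.RiemannHypothesis.Theorems.WeilFormatC

open Literature.NumberTheory.LFunctions Literature.NumberTheory.LFunctions.Yoshida1992
open Literature.Analysis.SpecialFunctions

variable {a : ℝ}

/-! ## The tail majorant (mean-square form) -/

section Tail

/-- **Odd tail majorant at order `J`, mean-square form.**  See the module docstring. -/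
theorem odd_tailJMS_majorant (ha : 0 < a) {B B₃ : ℕ} (hB : 1 ≤ B) (hBB : 2 * B ≤ B₃) (J : ℕ)
    (d : ℕ → ℝ) {d₀ : ℝ} (hd₀ : 0 < d₀) (hd : ∀ l, B₃ ≤ l → d₀ ≤ d l) {θ η : ℝ} (hθ : 0 < θ) (hη : 0 < η)
    (s₁ : ℕ → ℝ) (sm sp : ℕ → ℕ → ℝ)
    (hs₁ : ∀ k ∈ weilPrimeIndex a, IsPrimePow k → 0 ≤ s₁ k ∧ s₁ k ≤ |Real.sin (π * Real.log k / a / 2)|)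
    (hsm : ∀ k ∈ weilPrimeIndex a, ∀ k' ∈ weilPrimeIndex a, IsPrimePow k → IsPrimePow k' → k ≠ k' →
      0 ≤ sm k k' ∧ sm k k' ≤ |Real.sin ((π * Real.log k / a - π * Real.log k' / a) / 2)|)
    (hsp : ∀ k ∈ weilPrimeIndex a, ∀ k' ∈ weilPrimeIndex a, IsPrimePow k → IsPrimePow k' →
      0 ≤ sp k k' ∧ sp k k' ≤ |Real.sin ((π * Real.log k / a + π * Real.log k' / a) / 2)|)
    (N : ℕ) (x : Fin B → ℝ) :
    ∑ l ∈ Finset.Ico B₃ N, (∑ k : Fin B,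
        ((gramCoeff a (((k : ℕ) : ℤ) + 1) ((l : ℤ) + 1) - gramCoeff a (((k : ℕ) : ℤ) + 1) (-((l : ℤ) + 1))) / 2) * x k) ^ 2 / d l
      ≤ (1 + θ) * (1 + η) * (1 / (π ^ 2 * d₀))
          * (((π / 4 + a * (1 + weilArchDensity (2 * a)) / (π * (((B₃ + 1 : ℕ) : ℝ)))) ^ 2 + (∑ k ∈ weilPrimeIndex a, ((Λ k : ℝ) / Real.sqrt k) ^ 2) / 2 + 2 * (a * (1 + weilArchDensity (2 * a)) / (π * (((B₃ + 1 : ℕ) : ℝ)))) * (∑ k ∈ weilPrimeIndex a, (Λ k : ℝ) / Real.sqrt k) + ((π / 2) * (∑ k ∈ weilPrimeIndex a, if s₁ k = 0 then (Λ k : ℝ) / Real.sqrt k else 0) + (∑ k ∈ weilPrimeIndex a, ∑ k' ∈ (weilPrimeIndex a).erase k, if sm k k' = 0 then (Λ k : ℝ) / Real.sqrt k * ((Λ k' : ℝ) / Real.sqrt k') else 0) / 2 + (∑ k ∈ weilPrimeIndex a, ∑ k' ∈ weilPrimeIndex a, if sp k k' = 0 then (Λ k : ℝ) / Real.sqrt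 k * ((Λ k' : ℝ) / Real.sqrt k') else 0) / 2))
              * ((∑ j : Fin J, ∑ j' : Fin J,
                  (∑ k : Fin B, ((-1 : ℝ) ^ ((k : ℕ) + 1) * (((k : ℕ) : ℝ) + 1) ^ (2 * (j : ℕ) + 1)) * x k)
                  * (∑ k : Fin B, ((-1 : ℝ) ^ ((k : ℕ) + 1) * (((k : ℕ) : ℝ) + 1) ^ (2 * (j' : ℕ) + 1)) * x k)
                  * ((1 / (((2 * (j : ℕ) + 2) + (2 * (j' : ℕ) + 2) - 1 : ℕ) * (B₃ : ℝ) ^ ((2 * (j : ℕ) + 2) + (2 * (j' : ℕ) + 2) - 1)) + 1 / (((2 * (j : ℕ) + 2) + (2 * (j' : ℕ) + 2) - 1 : ℕ) * ((B₃ + 1 : ℕ) : ℝ) ^ ((2 * (j : ℕ) + 2) + (2 * (j' : ℕ) + 2) - 1))) / 2))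
                + ∑ j : Fin J, (∑ k : Fin B, ((-1 : ℝ) ^ ((k : ℕ) + 1) * (((k : ℕ) : ℝ) + 1) ^ (2 * (j : ℕ) + 1)) * x k) ^ 2
                  * ∑ j' : Fin J, ((1 / (((2 * (j : ℕ) + 2) + (2 * (j' : ℕ) + 2) - 1 : ℕ) * (B₃ : ℝ) ^ ((2 * (j : ℕ) + 2) + (2 * (j' : ℕ) + 2) - 1)) - 1 / (((2 * (j : ℕ) + 2) + (2 * (j' : ℕ) + 2) - 1 : ℕ) * ((B₃ + 1 : ℕ) : ℝ) ^ ((2 * (j : ℕ) + 2) + (2 * (j' : ℕ) + 2) - 1))) / 2) * (B : ℝ) ^ (2 * (j' : ℕ) + 2) / (B : ℝ) ^ (2 * (j : ℕ) + 2))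
            + ∑ j : Fin J, (∑ k : Fin B, ((-1 : ℝ) ^ ((k : ℕ) + 1) * (((k : ℕ) : ℝ) + 1) ^ (2 * (j : ℕ) + 1)) * x k) ^ 2
                * ∑ j' : Fin J, ((π / 2) * (∑ k ∈ weilPrimeIndex a, (Λ k : ℝ) / Real.sqrt k / s₁ k) + (∑ k ∈ weilPrimeIndex a, ∑ k' ∈ (weilPrimeIndex a).erase k, (Λ k : ℝ) / Real.sqrt k * ((Λ k' : ℝ) / Real.sqrt k') / sm k k') / 2 + (∑ k ∈ weilPrimeIndex a, ∑ k' ∈ weilPrimeIndex a, (Λ k : ℝ) / Real.sqrt k * ((Λ k' : ℝ) / Real.sqrt k') / sp k k') / 2) / (((B₃ + 1 : ℕ) : ℝ)) ^ ((2 * (j : ℕ) + 2) + (2 * (j' : ℕ) + 2)) * (B : ℝ) ^ (2 * (j' : ℕ) + 2) / (B : ℝ) ^ (2 * (j : ℕ) + 2))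
        + (1 + θ) * (1 + η⁻¹) * (1 / d₀)
          * ((∑ r : Fin J, ∑ r' : Fin J,
                (∑ k : Fin B, ((-1 : ℝ) ^ ((k : ℕ) + 1) * (-((((k : ℕ) : ℝ) + 1) ^ (2 * (r : ℕ))) * ((Complex.digamma (1 / 4 + ((freq a (((k : ℕ) : ℤ) + 1) : ℝ) : ℂ) / 2 * I)).im / 2 + (∑ p ∈ weilPrimeIndex a, (Λ p : ℝ) / Real.sqrt p * Real.sin (freq a (((k : ℕ) : ℤ) + 1) * Real.log p)) - archExpSumSin a (((k : ℕ) : ℤ) + 1)) / π - 4 * (Real.exp (a / 2) - Real.exp (-(a / 2))) ^ 2 / π * (-1 : ℝ) ^ (r : ℕ) * (a ^ 2 / (4 * π ^ 2)) ^ (r : ℕ) * (freq a (((k : ℕ) : ℤ) + 1) / (1 + 4 * freq a (((k : ℕ) : ℤ) + 1) ^ 2)))) * x k)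
                * (∑ k : Fin B, ((-1 : ℝ) ^ ((k : ℕ) + 1) * (-((((k : ℕ) : ℝ) + 1) ^ (2 * (r' : ℕ))) * ((Complex.digamma (1 / 4 + ((freq a (((k : ℕ) : ℤ) + 1) : ℝ) : ℂ) / 2 * I)).im / 2 + (∑ p ∈ weilPrimeIndex a, (Λ p : ℝ) / Real.sqrt p * Real.sin (freq a (((k : ℕ) : ℤ) + 1) * Real.log p)) - archExpSumSin a (((k : ℕ) : ℤ) + 1)) / π - 4 * (Real.exp (a / 2) - Real.exp (-(a / 2))) ^ 2 / π * (-1 : ℝ) ^ (r' : ℕ) * (a ^ 2 / (4 * π ^ 2)) ^ (r' : ℕ) * (freq a (((k : ℕ) : ℤ) + 1) / (1 + 4 * freq a (((k : ℕ) : ℤ) + 1) ^ 2)))) * x k)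
                * ((1 / (((2 * (r : ℕ) + 1) + (2 * (r' : ℕ) + 1) - 1 : ℕ) * (B₃ : ℝ) ^ ((2 * (r : ℕ) + 1) + (2 * (r' : ℕ) + 1) - 1)) + 1 / (((2 * (r : ℕ) + 1) + (2 * (r' : ℕ) + 1) - 1 : ℕ) * ((B₃ + 1 : ℕ) : ℝ) ^ ((2 * (r : ℕ) + 1) + (2 * (r' : ℕ) + 1) - 1))) / 2))
              + ∑ r : Fin J, (∑ k : Fin B, ((-1 : ℝ) ^ ((k : ℕ) + 1) * (-((((k : ℕ) : ℝ) + 1) ^ (2 * (r : ℕ))) * ((Complex.digamma (1 / 4 + ((freq a (((k : ℕ) : ℤ) + 1) : ℝ) : ℂ) / 2 * I)).im / 2 + (∑ p ∈ weilPrimeIndex a, (Λ p : ℝ) / Real.sqrt p * Real.sin (freq a (((k : ℕ) : ℤ) + 1) * Real.log p)) - archExpSumSin a (((k : ℕ) : ℤ) + 1)) / π - 4 * (Real.exp (a / 2) - Real.exp (-(a / 2))) ^ 2 / π * (-1 : ℝ) ^ (r : ℕ) * (a ^ 2 / (4 * π ^ 2)) ^ (r : ℕ) * (freq a (((k : ℕ)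 : ℤ) + 1) / (1 + 4 * freq a (((k : ℕ) : ℤ) + 1) ^ 2)))) * x k) ^ 2
                * ∑ r' : Fin J, ((1 / (((2 * (r : ℕ) + 1) + (2 * (r' : ℕ) + 1) - 1 : ℕ) * (B₃ : ℝ) ^ ((2 * (r : ℕ) + 1) + (2 * (r' : ℕ) + 1) - 1)) - 1 / (((2 * (r : ℕ) + 1) + (2 * (r' : ℕ) + 1) - 1 : ℕ) * ((B₃ + 1 : ℕ) : ℝ) ^ ((2 * (r : ℕ) + 1) + (2 * (r' : ℕ) + 1) - 1))) / 2) * (B : ℝ) ^ (2 * (r' : ℕ) + 1) / (B : ℝ) ^ (2 * (r : ℕ) + 1))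
        + (1 + θ⁻¹) * ((B : ℝ) / (d₀ * ((4 * J + 1 : ℕ) * (B₃ : ℝ) ^ (4 * J + 1))))
          * ∑ k : Fin B, (2 * (π / 4 + (∑ k ∈ weilPrimeIndex a, (Λ k : ℝ) / Real.sqrt k) + a * (1 + weilArchDensity (2 * a)) / π) * (((k : ℕ) : ℝ) + 1) ^ (2 * J) / π + 4 * (Real.exp (a / 2) - Real.exp (-(a / 2))) ^ 2 / π * (a ^ 2 / (4 * π ^ 2)) ^ J * (freq a (((k : ℕ) : ℤ) + 1) / (1 + 4 * freq a (((k : ℕ) : ℤ) + 1) ^ 2))) ^ 2 * x k ^ 2 := by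
  -- abbreviations
  set T := Finset.Ico B₃ N with hT
  have hB₃2 : 2 ≤ B₃ := by omega
  have hB0 : (0 : ℝ) < B := by exact_mod_cast hB
  set Fmode : ℤ → ℝ := fun n ↦ (Complex.digamma (1 / 4 + ((freq a n : ℝ) : ℂ) / 2 * I)).im / 2
      + (∑ k ∈ weilPrimeIndex a, (Λ k : ℝ) / Real.sqrt k * Real.sin (freq a n * Real.log k)) - archExpSumSin a n
    with hFmode
  set S2 : ℝ := (Real.exp (a / 2) - Real.exp (-(a / 2))) ^ 2 with hS2
  set q : ℝ := a ^ 2 / (4 * π ^ 2) with hq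
  set dfac : ℤ → ℝ := fun n ↦ freq a n / (1 + 4 * freq a n ^ 2) with hdfac
  -- row functionals (row k = mode k+1)
  set vA : Fin J → Fin B → ℝ := fun j k ↦ (-1 : ℝ) ^ ((k : ℕ) + 1) * (((k : ℕ) : ℝ) + 1) ^ (2 * (j : ℕ) + 1) with hvA
  set vB : Fin J → Fin B → ℝ := fun r k ↦ (-1 : ℝ) ^ ((k : ℕ) + 1) *
      (-((((k : ℕ) : ℝ) + 1) ^ (2 * (r : ℕ))) * Fmode (((k : ℕ) : ℤ) + 1) / π
        - 4 * S2 / π * (-1 : ℝ) ^ (r : ℕ) * q ^ (r : ℕ) * dfac (((k : ℕ) : ℤ) + 1)) with hvB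
  set αA : Fin J → ℝ := fun j ↦ ∑ k, vA j k * x k with hαA
  set αB : Fin J → ℝ := fun r ↦ ∑ k, vB r k * x k with hαB
  set ρ : Fin B → ℝ := fun k ↦ (2 * (π / 4 + (∑ k ∈ weilPrimeIndex a, (Λ k : ℝ) / Real.sqrt k)
        + a * (1 + weilArchDensity (2 * a)) / π) * (((k : ℕ) : ℝ) + 1) ^ (2 * J) / π
        + 4 * S2 / π * q ^ J * dfac (((k : ℕ) : ℤ) + 1)) with hρ
  set bcol : ℕ → Fin B → ℝ := fun l k ↦
    ((gramCoeff a (((k : ℕ) : ℤ) + 1) ((l : ℤ) + 1) - gramCoeff a (((k : ℕ) : ℤ) + 1) (-((l : ℤ) + 1))) / 2) with hbcol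
  -- per-mode facts
  have hTl : ∀ l ∈ T, B₃ ≤ l := fun l hl ↦ (Finset.mem_Ico.mp hl).1
  have key : ∀ l ∈ T, (∑ k, bcol l k * x k) ^ 2 / d l
      ≤ (1 + θ) * (1 + η) * (1 / (π ^ 2 * d₀)) * (Fmode ((l : ℤ) + 1) ^ 2 * (∑ j, αA j / ((l : ℝ) + 1) ^ (2 * (j : ℕ) + 2)) ^ 2)
        + (1 + θ) * (1 + η⁻¹) * (1 / d₀) * (∑ r, αB r / ((l : ℝ) + 1) ^ (2 * (r : ℕ) + 1)) ^ 2
        + (1 + θ⁻¹) * ((B : ℝ) / d₀) * (∑ k, ρ k ^ 2 * x k ^ 2) * (1 / (((l : ℝ) + 1) ^ (2 * J + 1)) ^ 2) := by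
    intro l hl
    have hlB := hTl l hl
    have hl0 : (0 : ℝ) < (l : ℝ) + 1 := by positivity
    have hdl : d₀ ≤ d l := hd l hlB
    have hdpos : 0 < d l := lt_of_lt_of_le hd₀ hdl
    -- decomposition of the column sum (modes i = k+1, m = l+1)
    set R : ℝ := ∑ k, (bcol l k - (-1 : ℝ) ^ (l + 1) *
        (Fmode ((l : ℤ) + 1) / π * ∑ j ∈ Finset.range J,
            ((-1 : ℝ) ^ ((k : ℕ) + 1) * (((k : ℕ) : ℝ) + 1) ^ (2 * j + 1)) / ((l : ℝ) + 1) ^ (2 * j + 2)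
          + ∑ r ∈ Finset.range J, ((-1 : ℝ) ^ ((k : ℕ) + 1) *
              (-((((k : ℕ) : ℝ) + 1) ^ (2 * r)) * Fmode (((k : ℕ) : ℤ) + 1) / π
                - 4 * S2 / π * (-1 : ℝ) ^ r * q ^ r * dfac (((k : ℕ) : ℤ) + 1))) / ((l : ℝ) + 1) ^ (2 * r + 1)))
        * x k with hR
    have hsplit : ∑ k, bcol l k * x k = (-1 : ℝ) ^ (l + 1) *
        (Fmode ((l : ℤ) + 1) / π * (∑ j, αA j / ((l : ℝ) + 1) ^ (2 * (j : ℕ) + 2))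
          + (∑ r, αB r / ((l : ℝ) + 1) ^ (2 * (r : ℕ) + 1))) + R := by
      have ePA : (∑ j, αA j / ((l : ℝ) + 1) ^ (2 * (j : ℕ) + 2)) = ∑ k : Fin B, (∑ j ∈ Finset.range J,
          ((-1 : ℝ) ^ ((k : ℕ) + 1) * (((k : ℕ) : ℝ) + 1) ^ (2 * j + 1)) / ((l : ℝ) + 1) ^ (2 * j + 2)) * x k := by
        simp only [hαA, hvA, Finset.sum_div]
        rw [Finset.sum_comm]
        refine Finset.sum_congr rfl fun k _ ↦ ?_
        rw [Finset.sum_mul, Finset.sum_range]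
        refine Finset.sum_congr rfl fun j _ ↦ by ring
      have ePB : (∑ r, αB r / ((l : ℝ) + 1) ^ (2 * (r : ℕ) + 1)) = ∑ k : Fin B, (∑ r ∈ Finset.range J,
          ((-1 : ℝ) ^ ((k : ℕ) + 1) *
            (-((((k : ℕ) : ℝ) + 1) ^ (2 * r)) * Fmode (((k : ℕ) : ℤ) + 1) / π
              - 4 * S2 / π * (-1 : ℝ) ^ r * q ^ r * dfac (((k : ℕ) : ℤ) + 1))) / ((l : ℝ) + 1) ^ (2 * r + 1)) * x k := by
        simp only [hαB, hvB, Finset.sum_div]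
        rw [Finset.sum_comm]
        refine Finset.sum_congr rfl fun k _ ↦ ?_
        rw [Finset.sum_mul, Finset.sum_range]
        refine Finset.sum_congr rfl fun r _ ↦ by ring
      rw [ePA, ePB, hR, Finset.mul_sum, mul_add, Finset.mul_sum, Finset.mul_sum, ← Finset.sum_add_distrib,
        ← Finset.sum_add_distrib]
      refine Finset.sum_congr rfl fun k _ ↦ by ring
    -- the remainder bound per row, via the mode-level decomposition lemma
    have hrow : ∀ k : Fin B, abs (bcol l k - (-1 : ℝ) ^ (l + 1) *
        (Fmode ((l : ℤ) + 1) / π * ∑ j ∈ Finset.range J,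
            ((-1 : ℝ) ^ ((k : ℕ) + 1) * (((k : ℕ) : ℝ) + 1) ^ (2 * j + 1)) / ((l : ℝ) + 1) ^ (2 * j + 2)
          + ∑ r ∈ Finset.range J, ((-1 : ℝ) ^ ((k : ℕ) + 1) *
              (-((((k : ℕ) : ℝ) + 1) ^ (2 * r)) * Fmode (((k : ℕ) : ℤ) + 1) / π
                - 4 * S2 / π * (-1 : ℝ) ^ r * q ^ r * dfac (((k : ℕ) : ℤ) + 1))) / ((l : ℝ) + 1) ^ (2 * r + 1)))
        ≤ ρ k / ((l : ℝ) + 1) ^ (2 * J + 1) := by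
      intro k
      have him : 2 * ((k : ℕ) + 1) ≤ l + 1 := by have := k.isLt; omega
      have h := abs_oddKernel_col_sub_families_le ha (i := (k : ℕ) + 1) (m := l + 1) (by omega) him J
      simp only [hbcol, hFmode, hS2, hq, hdfac, hρ]
      push_cast at h ⊢
      exact h
    have hRsq : R ^ 2 ≤ (B : ℝ) * (∑ k, ρ k ^ 2 * x k ^ 2) * (1 / (((l : ℝ) + 1) ^ (2 * J + 1)) ^ 2) := by
      have h := sq_sum_mul_le_card_mul (ι := Fin B) _ (fun k ↦ ρ k / ((l : ℝ) + 1) ^ (2 * J + 1)) x hrow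
      simp only [Fintype.card_fin] at h
      refine h.trans (le_of_eq ?_)
      rw [mul_assoc, Finset.sum_mul]
      congr 1
      refine Finset.sum_congr rfl fun k _ ↦ ?_
      rw [div_pow]
      ring
    -- the structured part (the square of the mode function is KEPT)
    have hmain : (Fmode ((l : ℤ) + 1) / π * (∑ j, αA j / ((l : ℝ) + 1) ^ (2 * (j : ℕ) + 2))
          + (∑ r, αB r / ((l : ℝ) + 1) ^ (2 * (r : ℕ) + 1))) ^ 2
        ≤ (1 + η) * (1 / π ^ 2) * (Fmode ((l : ℤ) + 1) ^ 2 * (∑ j, αA j / ((l : ℝ) + 1) ^ (2 * (j : ℕ) + 2)) ^ 2)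
          + (1 + η⁻¹) * (∑ r, αB r / ((l : ℝ) + 1) ^ (2 * (r : ℕ) + 1)) ^ 2 := by
      have hpp := sq_add_le_peterPaul (p := Fmode ((l : ℤ) + 1) / π * (∑ j, αA j / ((l : ℝ) + 1) ^ (2 * (j : ℕ) + 2)))
        (q := (∑ r, αB r / ((l : ℝ) + 1) ^ (2 * (r : ℕ) + 1))) hη
      refine hpp.trans (le_of_eq ?_)
      rw [mul_pow, div_pow]
      ring
    have hsq : (∑ k, bcol l k * x k) ^ 2
        ≤ (1 + θ) * ((1 + η) * (1 / π ^ 2) * (Fmode ((l : ℤ) + 1) ^ 2 * (∑ j, αA j / ((l : ℝ) + 1) ^ (2 * (j : ℕ) + 2)) ^ 2)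
            + (1 + η⁻¹) * (∑ r, αB r / ((l : ℝ) + 1) ^ (2 * (r : ℕ) + 1)) ^ 2)
          + (1 + θ⁻¹) * ((B : ℝ) * (∑ k, ρ k ^ 2 * x k ^ 2) * (1 / (((l : ℝ) + 1) ^ (2 * J + 1)) ^ 2)) := by
      rw [hsplit]
      have hpp := sq_add_le_peterPaul (p := (-1 : ℝ) ^ (l + 1) *
        (Fmode ((l : ℤ) + 1) / π * (∑ j, αA j / ((l : ℝ) + 1) ^ (2 * (j : ℕ) + 2))
          + (∑ r, αB r / ((l : ℝ) + 1) ^ (2 * (r : ℕ) + 1)))) (q := R) hθ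
      have hsgn : ((-1 : ℝ) ^ (l + 1) *
          (Fmode ((l : ℤ) + 1) / π * (∑ j, αA j / ((l : ℝ) + 1) ^ (2 * (j : ℕ) + 2))
            + (∑ r, αB r / ((l : ℝ) + 1) ^ (2 * (r : ℕ) + 1)))) ^ 2
          = (Fmode ((l : ℤ) + 1) / π * (∑ j, αA j / ((l : ℝ) + 1) ^ (2 * (j : ℕ) + 2))
            + (∑ r, αB r / ((l : ℝ) + 1) ^ (2 * (r : ℕ) + 1))) ^ 2 := by
        rw [mul_pow, ← pow_mul, Even.neg_one_pow (by exact ⟨l + 1, by ring⟩), one_mul]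
      rw [hsgn] at hpp
      have h1 : 0 ≤ 1 + θ := by positivity
      have h2 : 0 ≤ 1 + θ⁻¹ := by positivity
      exact hpp.trans (add_le_add (mul_le_mul_of_nonneg_left hmain h1) (mul_le_mul_of_nonneg_left hRsq h2))
    have hnn : 0 ≤ (1 + θ) * ((1 + η) * (1 / π ^ 2) * (Fmode ((l : ℤ) + 1) ^ 2 * (∑ j, αA j / ((l : ℝ) + 1) ^ (2 * (j : ℕ) + 2)) ^ 2)
            + (1 + η⁻¹) * (∑ r, αB r / ((l : ℝ) + 1) ^ (2 * (r : ℕ) + 1)) ^ 2)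
          + (1 + θ⁻¹) * ((B : ℝ) * (∑ k, ρ k ^ 2 * x k ^ 2) * (1 / (((l : ℝ) + 1) ^ (2 * J + 1)) ^ 2)) := by
      have : 0 ≤ ∑ k, ρ k ^ 2 * x k ^ 2 := Finset.sum_nonneg fun k _ ↦ by positivity
      positivity
    calc (∑ k, bcol l k * x k) ^ 2 / d l
        ≤ _ := div_le_div_of_nonneg_right hsq hdpos.le
      _ ≤ ((1 + θ) * ((1 + η) * (1 / π ^ 2) * (Fmode ((l : ℤ) + 1) ^ 2 * (∑ j, αA j / ((l : ℝ) + 1) ^ (2 * (j : ℕ) + 2)) ^ 2)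
            + (1 + η⁻¹) * (∑ r, αB r / ((l : ℝ) + 1) ^ (2 * (r : ℕ) + 1)) ^ 2)
          + (1 + θ⁻¹) * ((B : ℝ) * (∑ k, ρ k ^ 2 * x k ^ 2) * (1 / (((l : ℝ) + 1) ^ (2 * J + 1)) ^ 2))) / d₀ :=
          div_le_div_of_nonneg_left hnn hd₀ hdl
      _ = _ := by
          field_simp
  -- sum over the tail (reindex l + 1 = m ∈ Ico (B₃+1) (N+1)) and apply the Hankel bounds
  have hsumA0 := sum_Ico_modeF_sq_mul_sq_le ha (by omega : 2 ≤ B₃ + 1) (D := J) (fun j ↦ 2 * (j : ℕ) + 2)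
    (fun j ↦ by omega) (fun j ↦ (B : ℝ) ^ (2 * (j : ℕ) + 2)) (fun j ↦ by positivity) s₁ sm sp hs₁ hsm hsp (N + 1) αA
  have hsumB0 := sum_Ico_sq_sum_div_pow_le (D := J) (fun r ↦ 2 * (r : ℕ) + 1) (fun r ↦ by omega) (by omega : 2 ≤ B₃ + 1)
    (fun r ↦ (B : ℝ) ^ (2 * (r : ℕ) + 1)) (fun r ↦ by positivity) (N + 1) αB
  have hsumR0 := sum_Ico_one_div_pow_two_mul_le (E := 2 * J + 1) (by omega) (by omega : 2 ≤ B₃ + 1) (N + 1)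
  have h4J : 2 * (2 * J + 1) - 1 = 4 * J + 1 := by omega
  rw [h4J] at hsumR0
  simp only [Nat.add_sub_cancel] at hsumA0 hsumB0 hsumR0
  have hreA : ∑ l ∈ T, Fmode ((l : ℤ) + 1) ^ 2 * (∑ j, αA j / ((l : ℝ) + 1) ^ (2 * (j : ℕ) + 2)) ^ 2
      = ∑ m ∈ Finset.Ico (B₃ + 1) (N + 1), ((Complex.digamma (1 / 4 + ((freq a m : ℝ) : ℂ) / 2 * I)).im / 2
          + (∑ k ∈ weilPrimeIndex a, (Λ k : ℝ) / Real.sqrt k * Real.sin (freq a m * Real.log k))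
          - archExpSumSin a m) ^ 2 * (∑ j, αA j / (m : ℝ) ^ (2 * (j : ℕ) + 2)) ^ 2 := by
    rw [hT, ← Finset.sum_Ico_add' (c := 1)]
    refine Finset.sum_congr rfl fun l _ ↦ ?_
    simp only [hFmode]
    push_cast
    ring
  have hreB : ∑ l ∈ T, (∑ r, αB r / ((l : ℝ) + 1) ^ (2 * (r : ℕ) + 1)) ^ 2
      = ∑ m ∈ Finset.Ico (B₃ + 1) (N + 1), (∑ r, αB r / (m : ℝ) ^ (2 * (r : ℕ) + 1)) ^ 2 := by
    rw [hT, ← Finset.sum_Ico_add' (c := 1)]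
    refine Finset.sum_congr rfl fun l _ ↦ ?_
    push_cast
    ring
  have hreR : ∑ l ∈ T, 1 / (((l : ℝ) + 1) ^ (2 * J + 1)) ^ 2
      = ∑ m ∈ Finset.Ico (B₃ + 1) (N + 1), 1 / ((m : ℝ) ^ (2 * J + 1)) ^ 2 := by
    rw [hT, ← Finset.sum_Ico_add' (c := 1)]
    refine Finset.sum_congr rfl fun l _ ↦ ?_
    push_cast
    ring
  have hsumA := (le_of_eq hreA).trans hsumA0
  have hsumB := (le_of_eq hreB).trans hsumB0
  have hR' : ∑ l ∈ T, 1 / (((l : ℝ) + 1) ^ (2 * J + 1)) ^ 2 ≤ 1 / ((4 * J + 1 : ℕ) * (B₃ : ℝ) ^ (4 * J + 1)) :=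
    (le_of_eq hreR).trans hsumR0
  -- the three coefficient signs
  have hcA : 0 ≤ (1 + θ) * (1 + η) * (1 / (π ^ 2 * d₀)) := by positivity
  have hcB : 0 ≤ (1 + θ) * (1 + η⁻¹) * (1 / d₀) := by positivity
  have hcR : 0 ≤ (1 + θ⁻¹) * ((B : ℝ) / d₀) * (∑ k, ρ k ^ 2 * x k ^ 2) := by
    have : 0 ≤ ∑ k, ρ k ^ 2 * x k ^ 2 := Finset.sum_nonneg fun k _ ↦ by positivity
    positivity
  have step1 : ∑ l ∈ T, (∑ k, bcol l k * x k) ^ 2 / d l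
      ≤ (1 + θ) * (1 + η) * (1 / (π ^ 2 * d₀)) * ∑ l ∈ T, (Fmode ((l : ℤ) + 1) ^ 2 * (∑ j, αA j / ((l : ℝ) + 1) ^ (2 * (j : ℕ) + 2)) ^ 2)
          + (1 + θ) * (1 + η⁻¹) * (1 / d₀) * ∑ l ∈ T, (∑ r, αB r / ((l : ℝ) + 1) ^ (2 * (r : ℕ) + 1)) ^ 2
          + (1 + θ⁻¹) * ((B : ℝ) / d₀) * (∑ k, ρ k ^ 2 * x k ^ 2) * ∑ l ∈ T, (1 / (((l : ℝ) + 1) ^ (2 * J + 1)) ^ 2) := by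
    refine (Finset.sum_le_sum key).trans (le_of_eq ?_)
    simp only [Finset.sum_add_distrib, ← Finset.mul_sum]
  have step2 := add_le_add (add_le_add (mul_le_mul_of_nonneg_left hsumA hcA) (mul_le_mul_of_nonneg_left hsumB hcB))
    (mul_le_mul_of_nonneg_left hR' hcR)
  refine (step1.trans step2).trans (le_of_eq ?_)
  simp only [hαA, hαB, hvA, hvB, hρ, hFmode, hS2, hq, hdfac]
  ring

/-- **Odd tail majorant at order `J`, mean-square form — matrix form** (`hU₂` of
`sum_range_mul_mul_nonneg_of_certificate_sum_split` for the odd sector). -/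
theorem odd_tailJMS_majorant_matrix (ha : 0 < a) {B B₃ : ℕ} (hB : 1 ≤ B) (hBB : 2 * B ≤ B₃) (J : ℕ)
    (d : ℕ → ℝ) {d₀ : ℝ} (hd₀ : 0 < d₀) (hd : ∀ l, B₃ ≤ l → d₀ ≤ d l) {θ η : ℝ} (hθ : 0 < θ) (hη : 0 < η)
    (s₁ : ℕ → ℝ) (sm sp : ℕ → ℕ → ℝ)
    (hs₁ : ∀ k ∈ weilPrimeIndex a, IsPrimePow k → 0 ≤ s₁ k ∧ s₁ k ≤ |Real.sin (π * Real.log k / a / 2)|)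
    (hsm : ∀ k ∈ weilPrimeIndex a, ∀ k' ∈ weilPrimeIndex a, IsPrimePow k → IsPrimePow k' → k ≠ k' →
      0 ≤ sm k k' ∧ sm k k' ≤ |Real.sin ((π * Real.log k / a - π * Real.log k' / a) / 2)|)
    (hsp : ∀ k ∈ weilPrimeIndex a, ∀ k' ∈ weilPrimeIndex a, IsPrimePow k → IsPrimePow k' →
      0 ≤ sp k k' ∧ sp k k' ≤ |Real.sin ((π * Real.log k / a + π * Real.log k' / a) / 2)|)
    (N : ℕ) (x : Fin B → ℝ) :
    ∑ l ∈ Finset.Ico B₃ N, (∑ k : Fin B,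
        ((gramCoeff a (((k : ℕ) : ℤ) + 1) ((l : ℤ) + 1) - gramCoeff a (((k : ℕ) : ℤ) + 1) (-((l : ℤ) + 1))) / 2) * x k) ^ 2 / d l
      ≤ x ⬝ᵥ (Matrix.of fun k k' : Fin B ↦
          (1 + θ) * (1 + η) * (1 / (π ^ 2 * d₀))
            * (∑ j : Fin J, ∑ j' : Fin J, (((π / 4 + a * (1 + weilArchDensity (2 * a)) / (π * (((B₃ + 1 : ℕ) : ℝ)))) ^ 2 + (∑ k ∈ weilPrimeIndex a, ((Λ k : ℝ) / Real.sqrt k) ^ 2) / 2 + 2 * (a * (1 + weilArchDensity (2 * a)) / (π * (((B₃ + 1 : ℕ) : ℝ)))) * (∑ k ∈ weilPrimeIndex a, (Λ k : ℝ) / Real.sqrt k) + ((π / 2) * (∑ k ∈ weilPrimeIndex a, if s₁ k = 0 then (Λ k : ℝ) / Real.sqrt k else 0) + (∑ k ∈ weilPrimeIndex a, ∑ k' ∈ (weilPrimeIndex a).erase k, if sm k k' = 0 then (Λ k : ℝ) / Real.sqrt k * ((Λ k' : ℝ) / Real.sqrt k') else 0) / 2 + (∑ k ∈ weilPrimeIndex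 a, ∑ k' ∈ weilPrimeIndex a, if sp k k' = 0 then (Λ k : ℝ) / Real.sqrt k * ((Λ k' : ℝ) / Real.sqrt k') else 0) / 2)) * ((1 / (((2 * (j : ℕ) + 2) + (2 * (j' : ℕ) + 2) - 1 : ℕ) * (B₃ : ℝ) ^ ((2 * (j : ℕ) + 2) + (2 * (j' : ℕ) + 2) - 1)) + 1 / (((2 * (j : ℕ) + 2) + (2 * (j' : ℕ) + 2) - 1 : ℕ) * ((B₃ + 1 : ℕ) : ℝ) ^ ((2 * (j : ℕ) + 2) + (2 * (j' : ℕ) + 2) - 1))) / 2) + (if j = j' then ((π / 4 + a * (1 + weilArchDensity (2 * a)) / (π * (((B₃ + 1 : ℕ) : ℝ)))) ^ 2 + (∑ k ∈ weilPrimeIndex a, ((Λ k : ℝ) / Real.sqrt k) ^ 2) / 2 + 2 * (a * (1 + weilArchDensity (2 * a)) / (π * (((B₃ + 1 : ℕ) : ℝ)))) * (∑ k ∈ weilPrimeIndex a, (Λ k : ℝ) / Real.sqrt k) + ((π / 2) * (∑ k ∈ weilPrimeIndex a, if s₁ k = 0 then (Λ k : ℝ) / Real.sqrt k else 0) + (∑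 k ∈ weilPrimeIndex a, ∑ k' ∈ (weilPrimeIndex a).erase k, if sm k k' = 0 then (Λ k : ℝ) / Real.sqrt k * ((Λ k' : ℝ) / Real.sqrt k') else 0) / 2 + (∑ k ∈ weilPrimeIndex a, ∑ k' ∈ weilPrimeIndex a, if sp k k' = 0 then (Λ k : ℝ) / Real.sqrt k * ((Λ k' : ℝ) / Real.sqrt k') else 0) / 2)) * (∑ j' : Fin J, ((1 / (((2 * (j : ℕ) + 2) + (2 * (j' : ℕ) + 2) - 1 : ℕ) * (B₃ : ℝ) ^ ((2 * (j : ℕ) + 2) + (2 * (j' : ℕ) + 2) - 1)) - 1 / (((2 * (j : ℕ) + 2) + (2 * (j' : ℕ) + 2) - 1 : ℕ) * ((B₃ + 1 : ℕ) : ℝ) ^ ((2 * (j : ℕ) + 2) + (2 * (j' : ℕ) + 2) - 1))) / 2) * (B : ℝ) ^ (2 * (j' : ℕ) + 2) / (B : ℝ) ^ (2 * (j : ℕ) + 2)) + (∑ j' : Fin J, ((π / 2) * (∑ k ∈ weilPrimeIndex a, (Λ k : ℝ) / Real.sqrt k / s₁ k) + (∑ k ∈ weilPrimeIndex a, ∑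 k' ∈ (weilPrimeIndex a).erase k, (Λ k : ℝ) / Real.sqrt k * ((Λ k' : ℝ) / Real.sqrt k') / sm k k') / 2 + (∑ k ∈ weilPrimeIndex a, ∑ k' ∈ weilPrimeIndex a, (Λ k : ℝ) / Real.sqrt k * ((Λ k' : ℝ) / Real.sqrt k') / sp k k') / 2) / (((B₃ + 1 : ℕ) : ℝ)) ^ ((2 * (j : ℕ) + 2) + (2 * (j' : ℕ) + 2)) * (B : ℝ) ^ (2 * (j' : ℕ) + 2) / (B : ℝ) ^ (2 * (j : ℕ) + 2)) else 0)) * ((-1 : ℝ) ^ ((k : ℕ) + 1) * (((k : ℕ) : ℝ) + 1) ^ (2 * (j : ℕ) + 1)) * ((-1 : ℝ) ^ ((k' : ℕ) + 1) * (((k' : ℕ) : ℝ) + 1) ^ (2 * (j' : ℕ) + 1)))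
          + (1 + θ) * (1 + η⁻¹) * (1 / d₀)
            * (∑ r : Fin J, ∑ r' : Fin J, (((1 / (((2 * (r : ℕ) + 1) + (2 * (r' : ℕ) + 1) - 1 : ℕ) * (B₃ : ℝ) ^ ((2 * (r : ℕ) + 1) + (2 * (r' : ℕ) + 1) - 1)) + 1 / (((2 * (r : ℕ) + 1) + (2 * (r' : ℕ) + 1) - 1 : ℕ) * ((B₃ + 1 : ℕ) : ℝ) ^ ((2 * (r : ℕ) + 1) + (2 * (r' : ℕ) + 1) - 1))) / 2) + (if r = r' then (∑ r' : Fin J, ((1 / (((2 * (r : ℕ) + 1) + (2 * (r' : ℕ) + 1) - 1 : ℕ) * (B₃ : ℝ) ^ ((2 * (r : ℕ) + 1) + (2 * (r' : ℕ) + 1) - 1)) - 1 / (((2 * (r : ℕ) + 1) + (2 * (r' : ℕ) + 1) - 1 : ℕ) * ((B₃ + 1 : ℕ) : ℝ) ^ ((2 * (r : ℕ) + 1) + (2 * (r' : ℕ) + 1) - 1))) / 2) * (B : ℝ) ^ (2 * (r' : ℕ) + 1) / (B : ℝ) ^ (2 * (r : ℕ) + 1)) else 0)) * ((-1 : ℝ)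 ^ ((k : ℕ) + 1) * (-((((k : ℕ) : ℝ) + 1) ^ (2 * (r : ℕ))) * ((Complex.digamma (1 / 4 + ((freq a (((k : ℕ) : ℤ) + 1) : ℝ) : ℂ) / 2 * I)).im / 2 + (∑ p ∈ weilPrimeIndex a, (Λ p : ℝ) / Real.sqrt p * Real.sin (freq a (((k : ℕ) : ℤ) + 1) * Real.log p)) - archExpSumSin a (((k : ℕ) : ℤ) + 1)) / π - 4 * (Real.exp (a / 2) - Real.exp (-(a / 2))) ^ 2 / π * (-1 : ℝ) ^ (r : ℕ) * (a ^ 2 / (4 * π ^ 2)) ^ (r : ℕ) * (freq a (((k : ℕ) : ℤ) + 1) / (1 + 4 * freq a (((k : ℕ) : ℤ) + 1) ^ 2)))) * ((-1 : ℝ) ^ ((k' : ℕ) + 1) * (-((((k' : ℕ) : ℝ) + 1) ^ (2 * (r' : ℕ))) * ((Complex.digamma (1 / 4 + ((freq a (((k' : ℕ) : ℤ) + 1) : ℝ) : ℂ) / 2 * I)).im / 2 + (∑ p ∈ weilPrimeIndex a, (Λ p : ℝ) / Real.sqrt p * Real.sin (freq a (((k' : ℕ) : ℤ) + 1) * Real.log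 p)) - archExpSumSin a (((k' : ℕ) : ℤ) + 1)) / π - 4 * (Real.exp (a / 2) - Real.exp (-(a / 2))) ^ 2 / π * (-1 : ℝ) ^ (r' : ℕ) * (a ^ 2 / (4 * π ^ 2)) ^ (r' : ℕ) * (freq a (((k' : ℕ) : ℤ) + 1) / (1 + 4 * freq a (((k' : ℕ) : ℤ) + 1) ^ 2)))))
          + (if k = k' then (1 + θ⁻¹) * ((B : ℝ) / (d₀ * ((4 * J + 1 : ℕ) * (B₃ : ℝ) ^ (4 * J + 1)))) * (2 * (π / 4 + (∑ k ∈ weilPrimeIndex a, (Λ k : ℝ) / Real.sqrt k) + a * (1 + weilArchDensity (2 * a)) / π) * (((k : ℕ) : ℝ) + 1) ^ (2 * J) / π + 4 * (Real.exp (a / 2) - Real.exp (-(a / 2))) ^ 2 / π * (a ^ 2 / (4 * π ^ 2)) ^ J * (freq a (((k : ℕ) : ℤ) + 1) / (1 + 4 * freq a (((k : ℕ) : ℤ) + 1) ^ 2))) ^ 2 else 0)) *ᵥ x := by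
  refine (odd_tailJMS_majorant ha hB hBB J d hd₀ hd hθ hη s₁ sm sp hs₁ hsm hsp N x).trans (le_of_eq ?_)
  rw [dotProduct_mulVec_eq_sum_sum]
  simp only [Matrix.of_apply]
  rw [sum_sum_mul_add3_eq, sum_sum_mul_gram_eq, sum_sum_mul_gram_eq, sum_sum_add_ite_mul_eq, sum_sum_add_ite_mul_eq,
    sum_sum_mul_scale_add_eq]

end Tail

end Summit.RiemannHypothesis.RiemannHypothesis.Theorems.WeilFormatC

end
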